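import Summits.Ventures.YMGap.RobustBall.PeriodisedLoads
import Summits.Ventures.YMGap.RobustBall.MassGapOnBallZdGMassive
import Summits.Ventures.YMGap.RobustBall.StringTensionOnBall
import Summits.Ventures.YMGap.RobustBall.RobustAreaLawUpTo
import Summits.Ventures.YMGap.RobustBall.AreaLawRadius
import Summits.Ventures.YMGap.RobustBall.RobustAreaLawPairW
import Summits.Ventures.YMGap.RobustBall.RowsSU2
import Summits.Ventures.YMGap.RobustBall.RowsSUN
import HarnessLib

/-!
# Venture YMGap, track ROBUST-BALL — the VAN HOVE JOIN, step 5: ONE STATE — the unique DLR state of a member of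
# the gauge-invariant `ℤ⁴` ball IS the infinite-volume limit of its torus states; it is MASSIVE and obeys the
# AREA LAW

HONEST FRAMING. WHAT THIS IS: a venture file (cell `pub-ymgap`, track Y2 ROBUST-BALL, seat ds-3) identifying the
track's two currencies for NON-Wilson members. For a member `(W, supp)` of ds-2's gauge-invariant tier-1 `ℤ⁴` ball
`MemBallZdG ε₀ ε₁ R` inside a MASS-GAP row (`PerturbedMassGapAt 4 N β W supp`: unique DLR state + clustering,
rb-p1's currency) the DLR state `μ` is unique, and by `mem_perturbedGibbsMeasures_of_mem_perturbedLimitPoints`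
(previous files) EVERY infinite-volume limit state of the perturbed torus states of the member's periodised family
is a DLR state, hence equals `μ`: `perturbedGibbsMeasures = {μ} = perturbedLimitPoints` (`oneState_of_perturbedMassGapAt`);
`μ` is an Osterwalder–Seiler massive state with plaquette–plaquette decay (ds-3's `massive_of_memBallZdG`); and if
the member's radii are also inside an AREA-LAW row (`AreaLawOnBall N 4 (Nβ) ε₀ ε₁ R (2R+1)`, rb-p2's currency, read on
limit states by `hasAreaLawWith_onBall`), the SAME state `μ` obeys the `ℤ⁴` area law `|⟨W(R×T)⟩_μ| ≤ C^{2(R+T)} e^{−cRT}`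
with the row's `(C, c)` (`oneState_onBallZdG`). CELLS (hypothesis-free, by name): `SU(2)` at `β_W = 1/8` on
`MemBallZdG 0.286 0.143 R` (`su2_oneState_1_8`: rb-p1's `su2_rowB_1_8` + rb-p2's UpTo area law on `(3/10, 3/20)`),
at `β_W = 3/20` (`su2_oneState_3_20`) and `β_W = 1/6` (`su2_oneState_1_6`); EVERY `N ≥ 2` at 't Hooft `1/64` on
`MemBallZdG (1/10) (1/10) R` (`suN_oneState_1_64`: p2's Bakry–Émery mass-gap row + ds-4's Bakry–Émery area-law row).
WHAT IT IS NOT: lattice strong-coupling statements; existence of the string tension of `μ` is not claimed (only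
the area-law upper bound); nothing about the continuum limit or the Clay Millennium problem.

References: H.-O. Georgii (2011) Thm. 4.17, Ch. 8; E. Seiler, LNP 159 (1982) Ch. 2; K. Osterwalder, E. Seiler,
Ann. Phys. 110 (1978) 440; the track's `MassGapOnBall.lean`, `MassGapOnBallZdG.lean`, `StringTensionOnBall.lean`,
`RobustAreaLawUpTo.lean`, `RobustAreaLawPairW.lean`, `RowsSU2.lean`, `RowsSUN.lean`; ds-3 `PeriodisedDLR.lean`,
`PeriodisedLoads.lean`, `MassGapOnBallZdGMassive.lean`.
-/

noncomputable section

open MeasureTheory Filter Topology Function Finset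
open scoped NNReal
open Literature.Probability.LatticeModels
open Literature.MathematicalPhysics.QuantumLattice hiding torusNorm
open Literature.MathematicalPhysics.QuantumFieldTheory hiding ZdEdge Site
open Literature.Barriers.QuantumFields (IsMassiveState)
open Summit.Ventures.YMGap.RobustBallSUN (suN_massGapOnBallZd_bakryEmery_dim4_row)

namespace Summit.Ventures.YMGap.RobustBall

variable {N : ℕ} {W : Potential (ZdEdge 4) (SUN N)} {supp : Finset (ZdEdge 4) → Finset (Finset (ZdEdge 4))}

/-! ### One state: DLR uniqueness identifies the torus limit -/

/-- ★★ **ONE STATE.** Let `(W, supp)` be a member of the gauge-invariant tier-1 `ℤ⁴` ball `MemBallZdG ε₀ ε₁ R` with the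
mass gap `PerturbedMassGapAt 4 N β W supp` (`N ≥ 1`). Then there is ONE probability measure `μ` on `SU(N)^{links(ℤ⁴)}`
which is at once: the unique DLR state of the member (`perturbedGibbsMeasures … = {μ}`); the infinite-volume limit of
the member's perturbed TORUS states along every convergent subsequence of the periodised family
(`perturbedLimitPoints … = {μ}`); an Osterwalder–Seiler MASSIVE state with exponentially decaying plaquette–plaquette
correlation function. (The four proof arguments are those of `periodisedFamily`; e.g. `hmem.dependsOn`,
`hmem.gaugeInvariant`, measurability and boundedness from `hmem.continuous`.) [folklore] -/
theorem oneState_of_perturbedMassGapAt (hN : 1 ≤ N) {β ε₀ ε₁ : ℝ} {R : ℕ} (hmem : MemBallZdG ε₀ ε₁ R W supp)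
    (hgap : PerturbedMassGapAt 4 N β W supp) (hdep : ∀ X, DependsOn (W X) (↑X : Set (ZdEdge 4)))
    (hg : ∀ X, IsZdGaugeInvariant (W X)) (hm : ∀ X, Measurable (W X)) (hb : ∀ X, ∃ C, ∀ U, |W X U| ≤ C) :
    ∃ μ : Measure (LGConfig 4 (SUN N)),
      perturbedGibbsMeasures (d := 4) (fundamentalRep (Fin N)) ((N : ℝ) * β) W supp = {μ} ∧
      perturbedLimitPoints ((N : ℝ) * β) (periodisedFamily W supp hdep hg hm hb) = {μ} ∧
      IsMassiveState μ ∧ HasExponentialDecay (plaquetteCorrFn (fundamentalRep (Fin N)) μ) := by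
  obtain ⟨hsub, ⟨μ, hμ⟩⟩ := hgap.1
  have hdlr : ∀ ν ∈ perturbedLimitPoints ((N : ℝ) * β) (periodisedFamily W supp hdep hg hm hb),
      ν ∈ perturbedGibbsMeasures (d := 4) (fundamentalRep (Fin N)) ((N : ℝ) * β) W supp := fun ν hν =>
    mem_perturbedGibbsMeasures_of_mem_perturbedLimitPoints hdep hg hm hb hmem.supportedBy hmem.continuous
      hmem.range _ hν
  refine ⟨μ, Set.eq_singleton_iff_unique_mem.2 ⟨hμ, fun ν hν => hsub hν hμ⟩,
    Set.eq_singleton_iff_unique_mem.2 ⟨?_, fun ν hν => hsub (hdlr ν hν) hμ⟩, ?_⟩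
  · obtain ⟨ν, hν⟩ := perturbedLimitPoints_nonempty ((N : ℝ) * β) (periodisedFamily W supp hdep hg hm hb)
    rwa [← hsub (hdlr ν hν) hμ]
  · exact (massive_of_memBallZdG hN hmem hgap).2 μ hμ

/-- ★★ **ONE STATE, MASSIVE AND AREA LAW.** If in addition the limit states of every family eventually in
`ClusterDomainFR ε₀ ε₁ R ∩ IsSlabLocal (2R+1)` obey the `ℤ⁴` area law with constants `(C, c)` at tree coupling `Nβ`
(the output of rb-p2's `hasAreaLawWith_onBall` from an `AreaLawOnBall N 4 (Nβ) ε₀ ε₁ R (2R+1)` row), then the one state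
`μ` of the member ALSO obeys `HasAreaLawWith μ χ_N C c` — the member's periodised family is such a family
(`MemBallZdG.eventually_periodisedFamily`). [folklore] -/
theorem oneState_areaLaw_of_perturbedMassGapAt (hN : 1 ≤ N) {β ε₀ ε₁ : ℝ} {R : ℕ} (hε₀ : 0 ≤ ε₀) (hε₁ : 0 ≤ ε₁)
    (hmem : MemBallZdG ε₀ ε₁ R W supp) (hgap : PerturbedMassGapAt 4 N β W supp)
    (hdep : ∀ X, DependsOn (W X) (↑X : Set (ZdEdge 4))) (hg : ∀ X, IsZdGaugeInvariant (W X))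
    (hm : ∀ X, Measurable (W X)) (hb : ∀ X, ∃ C, ∀ U, |W X U| ≤ C) {C c : ℝ}
    (hAL : ∀ 𝓦 : PerturbationFamily 4 N,
      (∀ᶠ L : ℕ in atTop, 𝓦 L ∈ ClusterDomainFR ε₀ ε₁ R ∧ IsSlabLocal (2 * R + 1) (𝓦 L)) →
        ∀ μ ∈ perturbedLimitPoints ((N : ℝ) * β) 𝓦,
          HasAreaLawWith μ (fun g => normalisedCharacter N (fundamentalRep (Fin N) g)) C c) :
    ∃ μ : Measure (LGConfig 4 (SUN N)),
      perturbedGibbsMeasures (d := 4) (fundamentalRep (Fin N)) ((N : ℝ) * β) W supp = {μ} ∧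
      perturbedLimitPoints ((N : ℝ) * β) (periodisedFamily W supp hdep hg hm hb) = {μ} ∧
      IsMassiveState μ ∧ HasExponentialDecay (plaquetteCorrFn (fundamentalRep (Fin N)) μ) ∧
      HasAreaLawWith μ (fun g => normalisedCharacter N (fundamentalRep (Fin N) g)) C c := by
  obtain ⟨μ, hG, hL, hM, hD⟩ := oneState_of_perturbedMassGapAt hN hmem hgap hdep hg hm hb
  refine ⟨μ, hG, hL, hM, hD, hAL _ ?_ μ (by rw [hL]; exact Set.mem_singleton μ)⟩
  exact MemBallZdG.eventually_periodisedFamily (n := 3) hmem hε₀ hε₁ hdep hg hm hb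

/-- ★★ **BALL FORM: mass-gap row + area-law row on the same gauge-invariant `ℤ⁴` ball ⇒ every member has ONE state,
massive AND area-law, with ONE `(C, c)` for the ball AT FIXED RANGE `R` (slab window `2R + 1`).** Inputs: `MassGapOnBallZdG 4 N β ε₀ ε₁ R` (or any landed
`MassGapOnBallZd` row via `massGapOnBallZdG_of_massGapOnBallZd`) and `AreaLawOnBall N 4 (Nβ) ε₀ ε₁ R (2R+1)`. [folklore] -/
theorem oneState_onBallZdG (hN : 1 ≤ N) {β ε₀ ε₁ : ℝ} {R : ℕ} (hε₀ : 0 ≤ ε₀) (hε₁ : 0 ≤ ε₁)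
    (hgap : MassGapOnBallZdG 4 N β ε₀ ε₁ R) (hAL : AreaLawOnBall N 4 ((N : ℝ) * β) ε₀ ε₁ R (2 * R + 1)) :
    ∃ C c : ℝ, 0 < c ∧ ∀ (W : Potential (ZdEdge 4) (SUN N)) (supp : Finset (ZdEdge 4) → Finset (Finset (ZdEdge 4)))
      (hmem : MemBallZdG ε₀ ε₁ R W supp) (hdep : ∀ X, DependsOn (W X) (↑X : Set (ZdEdge 4)))
      (hg : ∀ X, IsZdGaugeInvariant (W X)) (hm : ∀ X, Measurable (W X)) (hb : ∀ X, ∃ C, ∀ U, |W X U| ≤ C),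
      ∃ μ : Measure (LGConfig 4 (SUN N)),
        perturbedGibbsMeasures (d := 4) (fundamentalRep (Fin N)) ((N : ℝ) * β) W supp = {μ} ∧
        perturbedLimitPoints ((N : ℝ) * β) (periodisedFamily W supp hdep hg hm hb) = {μ} ∧
        IsMassiveState μ ∧ HasExponentialDecay (plaquetteCorrFn (fundamentalRep (Fin N)) μ) ∧
        HasAreaLawWith μ (fun g => normalisedCharacter N (fundamentalRep (Fin N) g)) C c := by
  obtain ⟨C, c, hc, hA⟩ := hasAreaLawWith_onBall (N := N) (d := 4) (by norm_num) hAL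
  exact ⟨C, c, hc, fun W supp hmem hdep hg hm hb =>
    oneState_areaLaw_of_perturbedMassGapAt hN hε₀ hε₁ hmem (hgap W supp hmem) hdep hg hm hb (hAL := hA)⟩

/-! ### Cells by name -/

/-- ★ **`SU(2)`, `ℤ⁴`, `β_W = 1/8`, HYPOTHESIS-FREE**: for every member of the gauge-invariant tier-1 ball
`MemBallZdG 0.286 0.143 R` — oscillation load `≤ 0.286`, site-incidence Lipschitz load `≤ 0.143`, range `R` — added to
`SU(2)` Wilson at `β_W = 1/8`: ONE state — the unique DLR state = the infinite-volume limit of the member's PERIODISED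
torus states — MASSIVE with plaquette–plaquette decay AND obeying the `ℤ⁴` area law; for each range `R` one pair
`(C, c)`, `c > 0`, serves every member of range `≤ R` (slab window `2R+1`) (mass gap: rb-p1's `su2_rowB_1_8`; area law:
rb-p2's `su2_areaLawOnBallUpTo_oneThird` on `(3/10, 3/20)` ⊇ `(0.286, 0.143)`). [folklore] -/
theorem su2_oneState_1_8 (R : ℕ) :
    ∃ C c : ℝ, 0 < c ∧ ∀ (W : Potential (ZdEdge 4) (SUN 2)) (supp : Finset (ZdEdge 4) → Finset (Finset (ZdEdge 4)))
      (hmem : MemBallZdG (2 * (143 / 1000)) (143 / 1000) R W supp) (hdep : ∀ X, DependsOn (W X) (↑X : Set (ZdEdge 4)))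
      (hg : ∀ X, IsZdGaugeInvariant (W X)) (hm : ∀ X, Measurable (W X)) (hb : ∀ X, ∃ C, ∀ U, |W X U| ≤ C),
      ∃ μ : Measure (LGConfig 4 (SUN 2)),
        perturbedGibbsMeasures (d := 4) (fundamentalRep (Fin 2)) (((2 : ℕ) : ℝ) * ((1 / 8 : ℝ) / 4)) W supp = {μ} ∧
        perturbedLimitPoints (((2 : ℕ) : ℝ) * ((1 / 8 : ℝ) / 4)) (periodisedFamily W supp hdep hg hm hb) = {μ} ∧
        IsMassiveState μ ∧ HasExponentialDecay (plaquetteCorrFn (fundamentalRep (Fin 2)) μ) ∧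
        HasAreaLawWith μ (fun g => normalisedCharacter 2 (fundamentalRep (Fin 2) g)) C c := by
  refine oneState_onBallZdG (N := 2) (by norm_num) (by norm_num) (by norm_num)
    (massGapOnBallZdG_of_massGapOnBallZd (su2_rowB_1_8 (R : ℝ))) ?_
  exact (areaLawOnBall_of_upTo (su2_areaLawOnBallUpTo_oneThird R (mv := 2 * R + 1) (by omega))
    (by norm_num) (by norm_num)).anti (by norm_num) (by norm_num) le_rfl le_rfl

/-- **`SU(2)`, `ℤ⁴`, `β_W = 3/20`**: ONE state, massive and area-law, on `MemBallZdG 0.17 0.085 R` (loads `≤ 0.17`,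
`≤ 0.085`; for each range `R` one `(C, c)`) — PERIODISED torus states (mass gap: rb-p1's `su2_rowB_3_20`; area law: the
UpTo row on `(3/10, 3/20)`). [folklore] -/
theorem su2_oneState_3_20 (R : ℕ) :
    ∃ C c : ℝ, 0 < c ∧ ∀ (W : Potential (ZdEdge 4) (SUN 2)) (supp : Finset (ZdEdge 4) → Finset (Finset (ZdEdge 4)))
      (hmem : MemBallZdG (2 * (17 / 200)) (17 / 200) R W supp) (hdep : ∀ X, DependsOn (W X) (↑X : Set (ZdEdge 4)))
      (hg : ∀ X, IsZdGaugeInvariant (W X)) (hm : ∀ X, Measurable (W X)) (hb : ∀ X, ∃ C, ∀ U, |W X U| ≤ C),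
      ∃ μ : Measure (LGConfig 4 (SUN 2)),
        perturbedGibbsMeasures (d := 4) (fundamentalRep (Fin 2)) (((2 : ℕ) : ℝ) * ((3 / 20 : ℝ) / 4)) W supp = {μ} ∧
        perturbedLimitPoints (((2 : ℕ) : ℝ) * ((3 / 20 : ℝ) / 4)) (periodisedFamily W supp hdep hg hm hb) = {μ} ∧
        IsMassiveState μ ∧ HasExponentialDecay (plaquetteCorrFn (fundamentalRep (Fin 2)) μ) ∧
        HasAreaLawWith μ (fun g => normalisedCharacter 2 (fundamentalRep (Fin 2) g)) C c := by
  refine oneState_onBallZdG (N := 2) (by norm_num) (by norm_num) (by norm_num)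
    (massGapOnBallZdG_of_massGapOnBallZd (su2_rowB_3_20 (R : ℝ))) ?_
  exact (areaLawOnBall_of_upTo (su2_areaLawOnBallUpTo_oneThird R (mv := 2 * R + 1) (by omega))
    (by norm_num) (by norm_num)).anti (by norm_num) (by norm_num) le_rfl le_rfl

/-- **`SU(2)`, `ℤ⁴`, `β_W = 1/6`** (the top of rb-p1's lineage-B window): ONE state, massive and area-law, on
`MemBallZdG 0.098 0.049 R` (loads `≤ 0.098`, `≤ 0.049`; for each range `R` one `(C, c)`) — PERIODISED torus states
(mass gap: `su2_rowB_1_6`; area law: the UpTo row). [folklore] -/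
theorem su2_oneState_1_6 (R : ℕ) :
    ∃ C c : ℝ, 0 < c ∧ ∀ (W : Potential (ZdEdge 4) (SUN 2)) (supp : Finset (ZdEdge 4) → Finset (Finset (ZdEdge 4)))
      (hmem : MemBallZdG (2 * (49 / 1000)) (49 / 1000) R W supp) (hdep : ∀ X, DependsOn (W X) (↑X : Set (ZdEdge 4)))
      (hg : ∀ X, IsZdGaugeInvariant (W X)) (hm : ∀ X, Measurable (W X)) (hb : ∀ X, ∃ C, ∀ U, |W X U| ≤ C),
      ∃ μ : Measure (LGConfig 4 (SUN 2)),
        perturbedGibbsMeasures (d := 4) (fundamentalRep (Fin 2)) (((2 : ℕ) : ℝ) * ((1 / 6 : ℝ) / 4)) W supp = {μ} ∧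
        perturbedLimitPoints (((2 : ℕ) : ℝ) * ((1 / 6 : ℝ) / 4)) (periodisedFamily W supp hdep hg hm hb) = {μ} ∧
        IsMassiveState μ ∧ HasExponentialDecay (plaquetteCorrFn (fundamentalRep (Fin 2)) μ) ∧
        HasAreaLawWith μ (fun g => normalisedCharacter 2 (fundamentalRep (Fin 2) g)) C c := by
  refine oneState_onBallZdG (N := 2) (by norm_num) (by norm_num) (by norm_num)
    (massGapOnBallZdG_of_massGapOnBallZd (su2_rowB_1_6 (R : ℝ))) ?_
  exact (areaLawOnBall_of_upTo (su2_areaLawOnBallUpTo_oneThird R (mv := 2 * R + 1) (by omega))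
    (by norm_num) (by norm_num)).anti (by norm_num) (by norm_num) le_rfl le_rfl

/-- ★ **EVERY `N ≥ 2`, `ℤ⁴`, 't Hooft coupling `1/64`, HYPOTHESIS-FREE, `N`-UNIFORM RADII**: for every member of
`MemBallZdG (1/10) (1/10) R` (oscillation load `≤ 1/10`, site-incidence Lipschitz load `≤ 1/10`, range `R`) added to
`SU(N)` Wilson at 't Hooft `1/64`: ONE state — the unique DLR state = the limit of the PERIODISED torus states —
massive with plaquette–plaquette decay and obeying the `ℤ⁴` area law; for each range `R` one `(C, c)` serving every
member of range `≤ R` (mass gap: p2's Bakry–Émery row `suN_massGapOnBallZd_bakryEmery_dim4_row`; area law: ds-4's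
`suN_areaLawOnBall_bakryEmery_dim4_row` on `(17/25, 17/50)` ⊇ `(1/10, 1/10)`). [folklore] -/
theorem suN_oneState_1_64 (hN : 2 ≤ N) (R : ℕ) :
    ∃ C c : ℝ, 0 < c ∧ ∀ (W : Potential (ZdEdge 4) (SUN N)) (supp : Finset (ZdEdge 4) → Finset (Finset (ZdEdge 4)))
      (hmem : MemBallZdG (1 / 10) (1 / 10) R W supp) (hdep : ∀ X, DependsOn (W X) (↑X : Set (ZdEdge 4)))
      (hg : ∀ X, IsZdGaugeInvariant (W X)) (hm : ∀ X, Measurable (W X)) (hb : ∀ X, ∃ C, ∀ U, |W X U| ≤ C),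
      ∃ μ : Measure (LGConfig 4 (SUN N)),
        perturbedGibbsMeasures (d := 4) (fundamentalRep (Fin N)) ((N : ℝ) * (1 / 64)) W supp = {μ} ∧
        perturbedLimitPoints ((N : ℝ) * (1 / 64)) (periodisedFamily W supp hdep hg hm hb) = {μ} ∧
        IsMassiveState μ ∧ HasExponentialDecay (plaquetteCorrFn (fundamentalRep (Fin N)) μ) ∧
        HasAreaLawWith μ (fun g => normalisedCharacter N (fundamentalRep (Fin N) g)) C c := by
  refine oneState_onBallZdG (N := N) (by omega) (by norm_num) (by norm_num)
    (massGapOnBallZdG_of_massGapOnBallZd (suN_massGapOnBallZd_bakryEmery_dim4_row hN (R : ℝ))) ?_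
  exact (suN_areaLawOnBall_bakryEmery_dim4_row hN R (mv := 2 * R + 1) (by omega)).anti
    (by norm_num) (by norm_num) le_rfl le_rfl

end Summit.Ventures.YMGap.RobustBall

end
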